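import Mathlib
import Summits.Ventures.PercRepro2.Defs
import Summits.Ventures.PercRepro2.Independence
import Summits.Ventures.PercRepro2.Harris
import Summits.Ventures.PercRepro2.Graph
import Summits.Ventures.PercRepro2.Exploration
import Summits.Ventures.PercRepro2.Events
import Summits.Ventures.PercRepro2.FourFunctions
import Summits.Ventures.PercRepro2.Induced
import Summits.Ventures.PercRepro2.Frontier
import Summits.Ventures.PercRepro2.ObsIndependence
import Summits.Ventures.PercRepro2.BHK
import Summits.Ventures.PercRepro2.BHKEvents
import Summits.Ventures.PercRepro2.MultiSource
import Summits.Ventures.PercRepro2.OrderPreservation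
import Summits.Ventures.PercRepro2.SeedSet
import Summits.Ventures.PercRepro2.MultiSourceFun
import Summits.Ventures.PercRepro2.CrossRootT
import Summits.Ventures.PercRepro2.VdBKahn
import Summits.Ventures.PercRepro2.GateDefs

/-!
# The marker-gate frame: event identities and the two hull-frame BHK inequalities
(blind cell PercRepro2, typer-1; the lemmas behind THEOREM (MARKER GATE), mine-c g6 MINE-C.md
§13.8 — split off `GateMarker.lean` (≤ 400-line files))

Root `s`, avoided set `T`, `K = hull(T) = C(T)`, `R = R_T`, markers `a, b`, gate set `B`.

* Event identities: `avoidAllT T ({s} ∪ B) = R ∩ {K avoids B}` (`avoidAllT_union_eq`),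
  `{K hits B}` / `{K avoids B}` as cluster-set events, `{a ∈ C(s)}` and `{a, b ∈ C(s)}` as cluster
  events, `hitsS {a} = {a ∈ C(s)}`;
* **(ii) `hits_Y_le`**: `P(Y; R, K hits B) · P(R) ≤ P(R, K hits B) · P(Y; R)` — `Y` and `{K hits B}`
  are negatively correlated given `R` (`bhk_cross_clusterT`, up-sets `{W hits B}`, `{S ∋ b}`);
* **(i) `hull_frame_pa`**: `P(X; R′) · P(Y; R′) ≤ P(XY; R′) · P(R′)` on `R′ = R ∩ {K avoids B}` —
  positive association of `X, Y` given `R′`: explore `K`; given `K = W` the events are the increasing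
  `{a ∈ C_{G−W}(s)}`, `{b ∈ C_{G−W}(s)}` (Harris in `G − W`: `delClusterProb_mul_le`), and the
  decreasing functionals `g_a, g_b` of `K` are positively correlated under the seed-set BHK with the
  avoided set `{s} ∪ B` (`bhk_multi`), through the tower identity
  `prob_clusterSetIn_inter_eq_expect` (`expect_del_indicator_eq`).
-/

namespace Summit.Ventures.PercRepro2

namespace Gate

open scoped Classical

variable {V : Type*} {E : Type*} [Fintype E] [DecidableEq E] [Fintype V] [DecidableEq V]
  {R : Type*} [Field R] [LinearOrder R] [IsStrictOrderedRing R]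

/-! ## Event identities -/

section Events

variable (ends : E → Sym2 V) (s : V) (T B : Finset V) (a b : V)

omit [Fintype E] [DecidableEq E] [Fintype V] in
/-- `{K avoids B}` as a seed-set avoidance: `avoidAllT T ({s} ∪ B) = R_T ∩ {K avoids B}`. -/
lemma avoidAllT_union_eq :
    avoidAllT ends T ({s} ∪ B) = avoidAll ends s T ∩ (hitsK ends T B)ᶜ := by
  ext ω
  simp only [avoidAllT, avoidAll, hitsK, Set.mem_setOf_eq, Set.mem_inter_iff, Set.mem_compl_iff,
    Finset.mem_union, Finset.mem_singleton]
  constructor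
  · intro h
    refine ⟨fun t ht hc => h t ht s (Or.inl rfl) (conn_symm hc), ?_⟩
    rintro ⟨w, hw, t, ht, hc⟩
    exact h t ht w (Or.inr hw) hc
  · rintro ⟨hR, hK⟩ t ht x hx hc
    rcases hx with rfl | hx
    · exact hR t ht (conn_symm hc)
    · exact hK ⟨x, hx, t, ht, hc⟩

omit [Fintype E] [DecidableEq E] [Fintype V] [DecidableEq V] in
/-- `{K hits B}` as a cluster-set event. -/
lemma clusterSetInEvent_hits :
    clusterSetInEvent ends T {W | ∃ w ∈ B, w ∈ W} = hitsK ends T B := by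
  ext ω
  simp only [clusterSetInEvent, hitsK, Set.mem_setOf_eq, mem_clusterSet]

omit [Fintype E] [DecidableEq E] [Fintype V] [DecidableEq V] in
/-- `{K avoids B}` as a cluster-set event. -/
lemma clusterSetInEvent_avoids :
    clusterSetInEvent ends T {W | ∀ w ∈ B, w ∉ W} = (hitsK ends T B)ᶜ := by
  ext ω
  simp only [clusterSetInEvent, hitsK, Set.mem_setOf_eq, mem_clusterSet, Set.mem_compl_iff,
    not_exists, not_and]

omit [Fintype E] [DecidableEq E] [Fintype V] [DecidableEq V] in
/-- `{a ∈ C(s)}` as a cluster event. -/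
lemma clusterInEvent_mem_eq : clusterInEvent ends s {S | a ∈ S} = connAll ends s {a} := by
  ext ω
  simp [clusterInEvent, connAll, mem_cluster]

omit [Fintype E] [DecidableEq E] [Fintype V] in
/-- `{a, b ∈ C(s)}` as a cluster event. -/
lemma clusterInEvent_mem_pair_eq :
    clusterInEvent ends s {S | a ∈ S ∧ b ∈ S} = connAll ends s ({a} ∪ {b}) := by
  ext ω
  simp only [clusterInEvent, connAll, Set.mem_setOf_eq, mem_cluster, Finset.mem_union,
    Finset.mem_singleton]
  constructor
  · rintro ⟨ha, hb⟩ x hx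
    rcases hx with rfl | rfl
    · exact ha
    · exact hb
  · intro h
    exact ⟨h a (Or.inl rfl), h b (Or.inr rfl)⟩

omit [Fintype E] [DecidableEq E] [Fintype V] [DecidableEq V] in
/-- `{s ∉ K}` is `R_T`. -/
lemma avoidAllT_singleton_eq : avoidAllT ends T {s} = avoidAll ends s T := by
  ext ω
  simp only [avoidAllT, avoidAll, Set.mem_setOf_eq, Finset.mem_singleton, forall_eq]
  exact ⟨fun h t ht hc => h t ht (conn_symm hc), fun h t ht hc => h t ht (conn_symm hc)⟩

omit [Fintype E] [DecidableEq E] [Fintype V] in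
/-- `{a, b ∈ C(s)} = {a ∈ C(s)} ∩ {b ∈ C(s)}`. -/
lemma connAll_pair_eq : connAll ends s ({a} ∪ {b}) = connAll ends s {a} ∩ connAll ends s {b} := by
  ext ω
  simp only [connAll, Set.mem_setOf_eq, Set.mem_inter_iff, Finset.mem_union, Finset.mem_singleton,
    forall_eq]
  constructor
  · intro h; exact ⟨h a (Or.inl rfl), h b (Or.inr rfl)⟩
  · rintro ⟨ha, hb⟩ x hx
    rcases hx with rfl | rfl
    · exact ha
    · exact hb

omit [Fintype E] [DecidableEq E] [Fintype V] [DecidableEq V] in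
/-- `hitsS {a} = {a ∈ C(s)}`. -/
lemma hitsS_singleton : hitsS ends s {a} = connAll ends s {a} := by
  ext ω
  simp [hitsS, connAll]

end Events

/-! ## The two hull-frame inequalities -/

section Hull

variable (p : E → R) (ends : E → Sym2 V) (s : V) (T B : Finset V) (a b : V)

omit [Fintype E] [DecidableEq E] [Fintype V] [DecidableEq V] [LinearOrder R] [IsStrictOrderedRing R] in
/-- Closing the edges at `W` is monotone in the configuration. -/
lemma delConfig_mono_config (W : Set V) {ω ω' : Config E} (h : ω ≤ ω') :
    delConfig ends W ω ≤ delConfig ends W ω' := by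
  intro e
  by_cases he : e ∈ touches ends W
  · rw [delConfig_apply_of_mem he]; exact Bool.false_le _
  · rw [delConfig_apply_of_notMem he, delConfig_apply_of_notMem he]; exact h e

omit [Fintype V] [DecidableEq V] in
/-- **Harris in `G − W`**: `g_{ab}(W) ≥ g_a(W) g_b(W)` for the increasing cluster events of the root. -/
lemma delClusterProb_mul_le (hp : IsProbVec p) (W : Set V) :
    delClusterProb p ends s {S | a ∈ S} W * delClusterProb p ends s {S | b ∈ S} W ≤
      delClusterProb p ends s {S | a ∈ S ∧ b ∈ S} W := by
  unfold delClusterProb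
  have hup : ∀ 𝓥 : Set (Set V), IsUpperSet 𝓥 →
      IsUpperSet {ω : Config E | cluster ends (delConfig ends W ω) s ∈ 𝓥} := by
    intro 𝓥 h𝓥 ω ω' hle hω
    exact h𝓥 (cluster_mono (delConfig_mono_config ends W hle) s) hω
  refine (prob_mul_prob_le_prob_inter hp (hup _ (fun _ _ h ha => h ha))
    (hup _ (fun _ _ h hb => h hb))).trans (le_of_eq ?_)
  congr 1

omit [DecidableEq V] in
/-- **(ii)** `Y` and `{K hits B}` are negatively correlated given `R_T`:
`P(Y; R, K hits B) · P(R) ≤ P(R, K hits B) · P(Y; R)`. -/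
lemma hits_Y_le (hp : IsProbVec p) :
    prob p (hitsK ends T B ∩ connAll ends s {b} ∩ avoidAll ends s T) * prob p (avoidAll ends s T) ≤
      prob p (hitsK ends T B ∩ avoidAll ends s T) *
        prob p (connAll ends s {b} ∩ avoidAll ends s T) := by
  have h := bhk_cross_clusterT p hp ends T s (𝓤 := {W | ∃ w ∈ B, w ∈ W}) (𝓥 := {S | b ∈ S})
    (fun _ _ hWW' ⟨w, hw, hwW⟩ => ⟨w, hw, hWW' hwW⟩) (fun _ _ h hb => h hb)
  rwa [clusterSetInEvent_hits, clusterInEvent_mem_eq, avoidAllT_singleton_eq] at h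

omit [Fintype E] [DecidableEq E] [LinearOrder R] [IsStrictOrderedRing R] in
/-- The weight of the avoidance `{s} ∪ B` is the product of the two indicators. -/
lemma indicator_avoid_mul (ω : Config E) :
    ({W : Set V | ∀ w ∈ B, w ∉ W}).indicator (1 : Set V → R) (clusterSet ends ω T) *
        (avoidAll ends s T).indicator (1 : Config E → R) ω =
      (avoidAllT ends T ({s} ∪ B)).indicator (1 : Config E → R) ω := by
  rw [avoidAllT_union_eq, ← clusterSetInEvent_avoids]
  by_cases hD : clusterSet ends ω T ∈ {W : Set V | ∀ w ∈ B, w ∉ W}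
  · by_cases hR : ω ∈ avoidAll ends s T
    · have hmem : ω ∈ avoidAll ends s T ∩ clusterSetInEvent ends T {W : Set V | ∀ w ∈ B, w ∉ W} :=
        ⟨hR, hD⟩
      rw [Set.indicator_of_mem hD, Set.indicator_of_mem hR, Set.indicator_of_mem hmem]
      simp
    · have hno : ω ∉ avoidAll ends s T ∩ clusterSetInEvent ends T {W : Set V | ∀ w ∈ B, w ∉ W} :=
        fun h => hR h.1
      rw [Set.indicator_of_notMem hR, Set.indicator_of_notMem hno]
      simp
  · have hno : ω ∉ avoidAll ends s T ∩ clusterSetInEvent ends T {W : Set V | ∀ w ∈ B, w ∉ W} :=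
      fun h => hD h.2
    rw [Set.indicator_of_notMem hD, Set.indicator_of_notMem hno]
    simp

omit [LinearOrder R] [IsStrictOrderedRing R] in
/-- The tower identity on `R ∩ {K avoids B}`: `E[g_𝓥(K) 1_{R'}] = P(C(s) ∈ 𝓥, R')`. -/
lemma expect_del_indicator_eq (𝓥 : Set (Set V)) :
    expect p (fun ω => delClusterProb p ends s 𝓥 (clusterSet ends ω T) *
        (avoidAllT ends T ({s} ∪ B)).indicator (1 : Config E → R) ω) =
      prob p (clusterInEvent ends s 𝓥 ∩ (avoidAll ends s T ∩ (hitsK ends T B)ᶜ)) := by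
  have h := prob_clusterSetIn_inter_eq_expect p ends T s {W | ∀ w ∈ B, w ∉ W} 𝓥
  rw [clusterSetInEvent_avoids, avoidAllT_singleton_eq] at h
  have e1 : (hitsK ends T B)ᶜ ∩ clusterInEvent ends s 𝓥 ∩ avoidAll ends s T =
      clusterInEvent ends s 𝓥 ∩ (avoidAll ends s T ∩ (hitsK ends T B)ᶜ) := by
    ext ω; simp only [Set.mem_inter_iff]; tauto
  rw [e1] at h
  rw [h]
  congr 1
  funext ω
  rw [← indicator_avoid_mul ends s T B ω]
  ring

/-- **(i)** positive association of `X, Y` given `R ∩ {K avoids B}` (the hull frame):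
`P(X; R′) · P(Y; R′) ≤ P(XY; R′) · P(R′)`, `R′ = R ∩ {K avoids B}`. -/
lemma hull_frame_pa (hp : IsProbVec p) :
    prob p (connAll ends s {a} ∩ (avoidAll ends s T ∩ (hitsK ends T B)ᶜ)) *
        prob p (connAll ends s {b} ∩ (avoidAll ends s T ∩ (hitsK ends T B)ᶜ)) ≤
      prob p (connAll ends s ({a} ∪ {b}) ∩ (avoidAll ends s T ∩ (hitsK ends T B)ᶜ)) *
        prob p (avoidAll ends s T ∩ (hitsK ends T B)ᶜ) := by
  set ga := delClusterProb p ends s {S | a ∈ S} with hga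
  set gb := delClusterProb p ends s {S | b ∈ S} with hgb
  set ind : Config E → R := (avoidAllT ends T ({s} ∪ B)).indicator 1 with hind
  have hmono : ∀ 𝓥 : Set (Set V), IsUpperSet 𝓥 →
      Monotone (fun W => 1 - delClusterProb p ends s 𝓥 W) := by
    intro 𝓥 h𝓥 W W' h
    simp only
    linarith [delClusterProb_anti p hp ends s h𝓥 h]
  have hnn : ∀ 𝓥 : Set (Set V), ∀ W, 0 ≤ 1 - delClusterProb p ends s 𝓥 W :=
    fun 𝓥 W => sub_nonneg.2 (delClusterProb_le_one p hp ends s 𝓥 W)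
  have key := bhk_multi p hp ends T (F₁ := fun W => 1 - ga W) (F₂ := fun W => 1 - gb W)
    (hmono _ (fun _ _ h ha => h ha)) (hmono _ (fun _ _ h hb => h hb)) (hnn _) (hnn _)
    ({s} ∪ B) ({s} ∪ B)
  rw [Finset.inter_self, Finset.union_self] at key
  simp only [Pi.mul_apply] at key
  -- the expectations
  have hd : prob p (avoidAllT ends T ({s} ∪ B)) = expect p ind := prob_eq_expect_indicator p _
  have hq := expect_del_indicator_eq p ends s T B {S | a ∈ S}
  have hyq := expect_del_indicator_eq p ends s T B {S | b ∈ S}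
  have hqy := expect_del_indicator_eq p ends s T B {S | a ∈ S ∧ b ∈ S}
  rw [clusterInEvent_mem_eq] at hq hyq
  rw [clusterInEvent_mem_pair_eq] at hqy
  have e1 : expect p (fun ω => (1 - ga (clusterSet ends ω T)) * ind ω) =
      expect p ind - expect p (fun ω => ga (clusterSet ends ω T) * ind ω) := by
    rw [← expect_sub]
    congr 1
    funext ω
    simp only [Pi.sub_apply]
    ring
  have e2 : expect p (fun ω => (1 - gb (clusterSet ends ω T)) * ind ω) =
      expect p ind - expect p (fun ω => gb (clusterSet ends ω T) * ind ω) := by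
    rw [← expect_sub]
    congr 1
    funext ω
    simp only [Pi.sub_apply]
    ring
  have e3 : expect p (fun ω => (1 - ga (clusterSet ends ω T)) * (1 - gb (clusterSet ends ω T)) *
      ind ω) ≤
      expect p ind - expect p (fun ω => ga (clusterSet ends ω T) * ind ω) -
        expect p (fun ω => gb (clusterSet ends ω T) * ind ω) +
        expect p (fun ω => delClusterProb p ends s {S | a ∈ S ∧ b ∈ S} (clusterSet ends ω T) *
          ind ω) := by
    have hpt : ∀ ω, (1 - ga (clusterSet ends ω T)) * (1 - gb (clusterSet ends ω T)) * ind ω ≤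
        (ind - (fun ω => ga (clusterSet ends ω T) * ind ω) -
          (fun ω => gb (clusterSet ends ω T) * ind ω) +
          fun ω => delClusterProb p ends s {S | a ∈ S ∧ b ∈ S} (clusterSet ends ω T) * ind ω) ω := by
      intro ω
      simp only [Pi.sub_apply, Pi.add_apply]
      have hind0 : 0 ≤ ind ω := by
        simp only [hind]
        exact Set.indicator_nonneg (fun _ _ => zero_le_one) ω
      have hH := delClusterProb_mul_le p ends s a b hp (clusterSet ends ω T)
      rw [← hga, ← hgb] at hH
      nlinarith [mul_le_mul_of_nonneg_right hH hind0]
    refine (expect_mono hp hpt).trans (le_of_eq ?_)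
    rw [expect_add, expect_sub, expect_sub]
  rw [e1, e2] at key
  have key' := key.trans (mul_le_mul_of_nonneg_right e3 (prob_nonneg hp _))
  rw [hd, hq, hyq, hqy] at key'
  rw [← hd] at key'
  rw [avoidAllT_union_eq] at key' hd
  rw [hd] at key' ⊢
  nlinarith [key']

end Hull

end Gate

end Summit.Ventures.PercRepro2
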